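import Summits.BirchSwinnertonDyer.Rank1Residual.Additive.CycLeadingTermDvdPotMult
import Literature.NumberTheory.EllipticCurves.Wuthrich2014.ThreeAdicImageSupersingularProofs
import HarnessLib

/-!
# `CycLeadingTermDvdPotMult` WITHOUT the binder `hL20` (Wuthrich's Lemma 20 is a tree theorem): binder-free twins

HONEST FRAMING (cell `b2b-bsdres`, run/shared/lean/b2b/bsd-rank1-residual/, verbatim in every
file): the goal of the cell is to DELETE the COMBINATION-SHAPED residual classes of the
Birch–Swinnerton-Dyer formula for ALL analytic-rank `≤ 1` elliptic curves over `ℚ` — "full BSD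
formula for every rank `≤ 1` curve in class `C`" assembled STRICTLY from published theorems — so
that the rank-`≤ 1` remainder becomes exactly the CONSTRUCTION-SHAPED classes, which are TYPED
(missing-input `Prop`s), NOT attempted. This is not "finishing BSD". Team n1011 (N10 / N11), seat
p05, OWNERS row T-b1ss = the `hL20`-BINDER SWEEP on `Additive/` + `AdditivePotMult/`: Wuthrich's
Lemma 20 (registry A9, the named fact `Wuthrich2014.lemma20_surjective_threeAdic_of_semistable`: at a
prime-to-`9` conductor, `ρ̄_{E,3}` onto ⟹ `ρ̄_{E,3ⁿ}` onto for all `n`) is a tree THEOREM since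
2026-08-21 (`Wuthrich2014.lemma20_surjective_threeAdic_of_semistable_holds`, file
`Literature/NumberTheory/EllipticCurves/Wuthrich2014/ThreeAdicImageSupersingularProofs.lean`, units
lit-kato / n1011-p02), so every theorem of the cell carrying it as a hypothesis has a twin WITHOUT that
binder.  This file states those twins for the theorems of its sibling (suffix `_noL20`; statement =
the sibling's statement with the binder deleted, other hypotheses unchanged; proof = the sibling's
theorem fed with `_holds`).  No claim beyond the stated classes; labels UNCHANGED; nothing is booked.
Theorems only (no definition, no named fact minted).

## What this file proves

Binder-free twins (`_noL20`) of the 1 theorems of `Summits/BirchSwinnertonDyer/Rank1Residual/Additive/CycLeadingTermDvdPotMult.lean` that carry the hypothesis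
`(hL20 : Wuthrich2014.lemma20_surjective_threeAdic_of_semistable)`:
* `ClassX4M.x4MissingInputAt_iff_cycLeadingTermDvdAt_rankZero_of_surj_noL20`

References: [Wuthrich2014] C. Wuthrich, Doc. Math. 19 (2014) 381–402, Lemma 20 (p. 399); the
sibling's references for everything else.
-/

noncomputable section

open scoped Classical NumberField

open WeierstrassCurve NumberField Literature.NumberTheory.EllipticCurves
  Literature.NumberTheory.EllipticCurves.ModularForms
  Literature.NumberTheory.EllipticCurves.Rank1Residual
  Literature.NumberTheory.EllipticCurves.Rank1Residual.Typed
  IsDedekindDomain Rat.HeightOneSpectrum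

namespace Summit.BirchSwinnertonDyer.Rank1Residual.AdditivePotMult

open Additive

variable {W : WeierstrassCurve ℚ} [W.IsElliptic] [W.IsGloballyMinimal] {p : ℕ} [hp : Fact p.Prime]

/-- **Binder-free twin of `ClassX4M.x4MissingInputAt_iff_cycLeadingTermDvdAt_rankZero_of_surj`** — the same statement WITHOUT the hypothesis
`Wuthrich2014.lemma20_surjective_threeAdic_of_semistable` (Wuthrich 2014 Lemma 20 = registry A9, now the tree
theorem `…_holds`); proof = the original fed with `_holds`. [cite: Wuthrich2014, Lemma 20 (p. 399)] -/
theorem ClassX4M.x4MissingInputAt_iff_cycLeadingTermDvdAt_rankZero_of_surj_noL20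
    (hDel : Delbourgo1998.prop4_rankZero_pow_dvd_constantCoeff)
    (hDelX : Delbourgo1998.prop4_rankZero_constantCoeff_eq_unit_mul_of_potMult)
    (hGZK : rank_eq_analyticRank_of_analyticRank_le_one) (hmod : hasEntireLFunction_rat)
    (hmodD : nonempty_modularParametrizationData)
    (hKato : Wuthrich2014.kato_halfEigenCharIdeal_dvd_cyclotomicPrime_of_surjective)
    (hX : ClassX4M W p) (hr : W.analyticRank = 0) (hsurj : Surj W p) :
    X4.MissingInputAt W p ↔ CycLeadingTermDvdAt W p :=
  ClassX4M.x4MissingInputAt_iff_cycLeadingTermDvdAt_rankZero_of_surj hDel hDelX hGZK hmod hmodD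
    Wuthrich2014.lemma20_surjective_threeAdic_of_semistable_holds hKato hX hr hsurj

end Summit.BirchSwinnertonDyer.Rank1Residual.AdditivePotMult

end
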